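import Mathlib
import Literature.AlgebraicGeometry.Resolution.ReflexiveModulesRationalDoublePoints
import Literature.AlgebraicGeometry.Resolution.ProperBirationalGlobalSections
import HarnessLib

/-!
# Crux `NoZenoR` / `NoZeno` (stmt-ResolutionOfSingularities-19943 / -16483), line `sandwich-cluster`,
# G-layer, G2: the FULL-SHEAF EMBEDDING `φ : M ↪ K(X)^r` of a finitely generated torsion-free module

OURS (cell res-hironaka, chain W4.4, res-L0-w44-stub-4 for the G2 holder res-D-pv-045 AS
res-L0-w44-stub-8; KERNEL-L0 §16 R6 row G2). Nothing here is a statement of the manuscript under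
review (Hironaka 2017) and nothing of `[claim: Hironaka2017]` is used; AI-written, weaker than expert
review.

The G2 assembly (`SketchG2Assembly.lean`, A7 `exists_locallyFree_stableEnd_equiv_cechMH1_of`) is stated
for a GIVEN embedding `φ : M → K(X)^r` (`T`-semilinear along `baseToFunctionField π`, injective, with
`K(X) · φ(M) = K(X)^r`), while G2-MAIN and the lead's consumed form `hG2` quantify over an abstract
finitely generated reflexive `T`-module `M`. This file supplies the embedding:

* `exists_injective_linearMap_pi_span_eq_top` — pure linear algebra: for `T` a domain with fraction
  field `K` (`[Algebra T K] [IsFractionRing T K]` as instance arguments, the convention of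
  `…NoZenoFullSheafEndLift`) and `M` finitely generated and torsion-free (`Module.IsTorsionFree`, automatic
  for reflexive modules: Mathlib `Module.IsReflexive.to_isTorsionFree`), there are `r : ℕ` and an
  injective `T`-linear `φ : M → K^r` whose image spans `K^r` over `K` (`K ⊗_T M ≅ K^r` by a basis,
  `M → K ⊗_T M` injective by torsion-freeness — Mathlib `tensorProduct_isLocalizedModule`,
  `IsLocalizedModule.eq_zero_iff`);
* `exists_injective_linearMap_pi_span_eq_top_finrank` — the same with `r = Module.finrank T M`
  (`IsLocalizedModule.finrank_eq`, `IsLocalization.rank_eq`), the rank convention of `IsChernDivisorOfFullSheaf`;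
* `exists_fullSheafEmbedding` — the `K(X)`-form in the additive-map convention of `SketchG2Split.lean`:
  for `π : X → Spec T` with `K(X) = Frac T` along `baseToFunctionField π` (tree
  `isFractionRing_baseToFunctionField`, p504390), `∃ r (φ : M →+ (Fin r → K(X)))`, injective, with
  `φ (a • m) = baseToFunctionField π a • φ m` and `K(X)`-span of `range φ` equal to `⊤`
  (`exists_fullSheafEmbedding_finrank`: `r = Module.finrank T M`; `…_of_isResolution[_finrank]`: the
  hypothesis discharged for a resolution of singularities `π`, or any proper birational `π`).

Everything is proved; no named facts. [this work]
-/

-- single-problem summit: the doubled namespace component `ResolutionOfSingularities` is forced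
set_option linter.dupNamespace false

noncomputable section

universe u v w

open CategoryTheory AlgebraicGeometry TensorProduct
open Literature.AlgebraicGeometry.Resolution

namespace Summit.ResolutionOfSingularities.ResolutionOfSingularities.Theorems.NoZeno.SandwichCluster.FullSheaf

section LinearAlgebra

variable {T : Type u} [CommRing T] [IsDomain T] (K : Type v) [Field K] [Algebra T K] [IsFractionRing T K]
variable (M : Type w) [AddCommGroup M] [Module T M] [Module.Finite T M] [Module.IsTorsionFree T M]

omit [Module.Finite T M] in
/-- `M → K ⊗_T M`, `m ↦ 1 ⊗ m`, is injective for `M` torsion-free over the domain `T` with fraction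
field `K` (it is a localization of `M` at `T ∖ 0`, whose elements act injectively on `M`). [folklore] -/
theorem mk_one_injective : Function.Injective (TensorProduct.mk T K M 1) := by
  rw [injective_iff_map_eq_zero]
  intro m hm
  obtain ⟨s, hs⟩ := (IsLocalizedModule.eq_zero_iff (nonZeroDivisors T) (TensorProduct.mk T K M 1)).mp hm
  have hs0 : ((s : T) • m) = 0 := hs
  rcases (Module.isTorsionFree_iff_smul_eq_zero.mp inferInstance (s : T) m hs0) with h | h
  · exact absurd h (nonZeroDivisors.coe_ne_zero s)
  · exact h

omit [IsDomain T] [IsFractionRing T K] [Module.Finite T M] [Module.IsTorsionFree T M] in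
/-- The `K`-span of the elementary tensors `1 ⊗ m` is all of `K ⊗_T M`. [folklore] -/
theorem span_range_mk_one_eq_top :
    Submodule.span K (Set.range (TensorProduct.mk T K M 1)) = ⊤ := by
  rw [eq_top_iff]
  rintro x -
  induction x using TensorProduct.induction_on with
  | zero => exact zero_mem _
  | tmul a m =>
    have h : a ⊗ₜ[T] m = a • (TensorProduct.mk T K M 1 m) := by
      rw [TensorProduct.mk_apply, TensorProduct.smul_tmul', smul_eq_mul, mul_one]
    rw [h]
    exact Submodule.smul_mem _ a (Submodule.subset_span ⟨m, rfl⟩)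
  | add x y hx hy => exact add_mem hx hy

/-- **A finitely generated torsion-free module over a domain embeds in `K^r` with `K`-spanning image**:
there are `r : ℕ` and an injective `T`-linear `φ : M → (Fin r → K)` with
`Submodule.span K (range φ) = ⊤` (`K ⊗_T M ≅ K^r` by a `K`-basis, composed with `m ↦ 1 ⊗ m`); here
`r = finrank_K (K ⊗_T M)`. [folklore] -/
theorem exists_injective_linearMap_pi_span_eq_top :
    ∃ (r : ℕ) (φ : M →ₗ[T] (Fin r → K)), Function.Injective φ ∧
      Submodule.span K (Set.range φ) = ⊤ ∧ r = Module.finrank K (K ⊗[T] M) := by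
  let n : ℕ := Module.finrank K (K ⊗[T] M)
  let e : (K ⊗[T] M) ≃ₗ[K] (Fin n → K) := (Module.finBasis K (K ⊗[T] M)).equivFun
  let φ : M →ₗ[T] (Fin n → K) := (e.restrictScalars T).toLinearMap ∘ₗ TensorProduct.mk T K M 1
  refine ⟨n, φ, ?_, ?_, rfl⟩
  · exact e.injective.comp (mk_one_injective K M)
  · have hr : Set.range φ = e '' Set.range (TensorProduct.mk T K M 1) := by
      rw [← Set.range_comp]
      rfl
    rw [hr, ← LinearEquiv.coe_coe, Submodule.span_image, span_range_mk_one_eq_top, Submodule.map_top,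
      LinearEquiv.range]

/-- The same with **`r = Module.finrank T M`** (the rank of the torsion-free module `M`, which equals
`finrank_K (K ⊗_T M)`: Mathlib `IsLocalizedModule.finrank_eq`, `IsLocalization.rank_eq`). [folklore] -/
theorem exists_injective_linearMap_pi_span_eq_top_finrank :
    ∃ φ : M →ₗ[T] (Fin (Module.finrank T M) → K), Function.Injective φ ∧
      Submodule.span K (Set.range φ) = ⊤ := by
  obtain ⟨r, φ, hφ, hspan, hr⟩ := exists_injective_linearMap_pi_span_eq_top (T := T) K M
  have hrank : Module.finrank T M = r := by
    rw [hr, ← IsLocalizedModule.finrank_eq (nonZeroDivisors T) (TensorProduct.mk T K M 1) le_rfl,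
      Module.finrank, Module.finrank, IsLocalization.rank_eq K (nonZeroDivisors T) le_rfl]
  subst hrank
  exact ⟨φ, hφ, hspan⟩

end LinearAlgebra

section FunctionField

variable {T : Type u} [CommRing T] [IsDomain T] {X : Scheme.{u}} [IsIntegral X]
  (π : X ⟶ Spec (.of T))
variable (M : Type w) [AddCommGroup M] [Module T M] [Module.Finite T M] [Module.IsTorsionFree T M]

/-- **The full-sheaf embedding** (convention of `SketchG2Split.lean` / `IsChernDivisorOfFullSheaf`): if
`K(X)` is a fraction field of `T` along `baseToFunctionField π` (e.g. `π` a resolution or any dominant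
map with an isomorphism of generic stalks, `isFractionRing_baseToFunctionField`), then every finitely
generated torsion-free `T`-module `M` admits an injective additive `φ : M → K(X)^r`, `T`-semilinear
along `baseToFunctionField π`, whose image spans `K(X)^r` over `K(X)`. [this work] -/
theorem exists_fullSheafEmbedding
    (hK : letI := (baseToFunctionField π).toAlgebra; IsFractionRing T X.functionField) :
    ∃ (r : ℕ) (φ : M →+ (Fin r → X.functionField)), Function.Injective φ ∧
      (∀ (a : T) (m : M), φ (a • m) = baseToFunctionField π a • φ m) ∧
      Submodule.span X.functionField (Set.range φ) = ⊤ := by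
  letI := (baseToFunctionField π).toAlgebra
  haveI := hK
  obtain ⟨r, φ, hφ, hspan, -⟩ := exists_injective_linearMap_pi_span_eq_top (T := T) X.functionField M
  refine ⟨r, φ.toAddMonoidHom, hφ, fun a m => ?_, hspan⟩
  change φ (a • m) = algebraMap T X.functionField a • φ m
  rw [map_smul, algebraMap_smul]

/-- The same with `r = Module.finrank T M`. [this work] -/
theorem exists_fullSheafEmbedding_finrank
    (hK : letI := (baseToFunctionField π).toAlgebra; IsFractionRing T X.functionField) :
    ∃ φ : M →+ (Fin (Module.finrank T M) → X.functionField), Function.Injective φ ∧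
      (∀ (a : T) (m : M), φ (a • m) = baseToFunctionField π a • φ m) ∧
      Submodule.span X.functionField (Set.range φ) = ⊤ := by
  letI := (baseToFunctionField π).toAlgebra
  haveI := hK
  obtain ⟨φ, hφ, hspan⟩ := exists_injective_linearMap_pi_span_eq_top_finrank (T := T) X.functionField M
  refine ⟨φ.toAddMonoidHom, hφ, fun a m => ?_, hspan⟩
  change φ (a • m) = algebraMap T X.functionField a • φ m
  rw [map_smul, algebraMap_smul]

/-- **The full-sheaf embedding for a resolution** `π : X → Spec T` (`K(X) = Frac T` by
`isFractionRing_baseToFunctionField`): every finitely generated torsion-free (e.g. reflexive) `T`-module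
embeds `T`-semilinearly into some `K(X)^r` with `K(X)`-spanning image. [this work] -/
theorem exists_fullSheafEmbedding_of_isResolution (hπ : IsResolution π) :
    ∃ (r : ℕ) (φ : M →+ (Fin r → X.functionField)), Function.Injective φ ∧
      (∀ (a : T) (m : M), φ (a • m) = baseToFunctionField π a • φ m) ∧
      Submodule.span X.functionField (Set.range φ) = ⊤ := by
  haveI : IsDominant π := hπ.isBirational.isDominant
  exact exists_fullSheafEmbedding π M
    (isFractionRing_baseToFunctionField π hπ.isBirational.isIso_stalkMap_genericPoint)

/-- The same with `r = Module.finrank T M`. [this work] -/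
theorem exists_fullSheafEmbedding_of_isResolution_finrank (hπ : IsResolution π) :
    ∃ φ : M →+ (Fin (Module.finrank T M) → X.functionField), Function.Injective φ ∧
      (∀ (a : T) (m : M), φ (a • m) = baseToFunctionField π a • φ m) ∧
      Submodule.span X.functionField (Set.range φ) = ⊤ := by
  haveI : IsDominant π := hπ.isBirational.isDominant
  exact exists_fullSheafEmbedding_finrank π M
    (isFractionRing_baseToFunctionField π hπ.isBirational.isIso_stalkMap_genericPoint)

end FunctionField

end Summit.ResolutionOfSingularities.ResolutionOfSingularities.Theorems.NoZeno.SandwichCluster.FullSheaf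

end
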